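import Literature.AnabelianGeometry.EtaleTheta.Discharge.Sec5CyclotomicCompatXRatFnForm
import Literature.AnabelianGeometry.EtaleTheta.TemperedFrobenioidRestrict
import Literature.AnabelianGeometry.EtaleTheta.Discharge.Sec3Thm37Units
import Literature.AnabelianGeometry.EtaleTheta.SectionTorsionSubgroup
import Literature.AnabelianGeometry.EtaleTheta.MonoThetaEnv
import Literature.AlgebraicGeometry.Frobenioids.ModelFrobenioidAutAction
import Literature.AlgebraicGeometry.Frobenioids.PreFrobenioidDataOfModel

/-!
# [EtTh] Lemma 5.8 proof p. 331 (PDF p. 105): TRUTH VALUES of the F-1306 rational-function clause (c1′) at model Frobenioids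
# and at the tree's CONSTRUCTED tempered Frobenioids (NV, proof-only)

Mochizuki, *The étale theta function …*, Publ. RIMS **45** (2009) [cite: MochizukiEtTh2009, Lem 5.8 proof p.331 (PDF p.105);
Def 3.6 (ii) p.303 (PDF p.77)]; Mochizuki, *The geometry of Frobenioids I*, Kyushu J. Math. **62** (2008), Thm. 5.2 (i) p. 100
[cite: MochizukiFrdI2008, Thm. 5.2 (i) p.100].  abc-iut cell, layer L2; row R228-NEXT of abc-iut-L2-lead (gen 4) «(c1′) AT A
CONCRETE FROBENIOID»; seat abc-iut-f-125 (gen 3).  PROOF-ONLY (theorems only; nothing landed is edited or restated).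

THE CLAUSE.  abc-iut-f-125 (gen 2) `Sec5CyclotomicCompatXRatFnForm` (p438316) showed that for every §5 datum assembled over a
tempered Frobenioid `tf` (`ThetaFrobenioid.ofBiKummerData`) the FACT-LIST row F-1306 `CyclotomicCharacterCompatX T' ι m` is
EQUIVALENT to   (c1′)  ∀ g, ∀ u u' ∈ μ_N(X):  u_{u'} = B((ρ g)⁻¹)(u_u) ⟹ m u' = χ'(g)(m u),
in which only the MODEL-FROBENIOID data of `tf` at `X = B_N` enter: the rational-function monoid `B` ([FrdI] Thm. 5.2 (i)), the
`N`-torsion `μ_N(X)` of `O^×(X)`, a Galois action `ρ : G → Aut_D(X^bs)`, a cyclotome reading `m : μ_N(X) ≃ M` and a character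
`χ' : G → Aut(M)` (there `χ' = χ_cyc ∘ aug ∘ ι`).  §0 records BY NAME that the clause below, written over
`PreFrobenioidData.ofModel Φ B Div_B`, IS that one (`ofBiKummerData_pre` is `rfl`).  Truth values:
* §1a — over ANY model Frobenioid (`Φ` divisorial), if `ρ` lifts to a homomorphism `e : G → Aut_C(X)` (a base-section; print's
  `s^trv_N`, `s^⊓-gp_N`), then (c1′) holds for `(m, χ')` IFF `χ'(g)(m u) = m(e(g) u e(g)⁻¹)`: the clause DETERMINES `χ'` as the
  base-conjugation character on `μ_N(X)` ([FrdI] Thm. 5.2 (i): a unit is determined by its rational function, and conjugation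
  pulls the rational function back along `Base`); in particular it is always SATISFIABLE (by that character) — F-1306's content
  is the identification of that character with `χ_cyc ∘ aug`.
* §1 — if every `ρ g` is trivial (every ONE-OBJECT-base toy: `Aut_{D₀}(*) = 1`), (c1′) ⟺ `χ'` ACTS TRIVIALLY on `M`; so NO
  instance of the sharp form (non-trivial `χ'`) lives over a base object without automorphisms, whatever the Frobenioid.
* §1b/§2/§3 — at abc-iut-w5-d164's `Toy.genuineTemperedFrobenioid R S` (genuine vocabularies, one-object `D`, `B₀ = 𝔭^ℤ`, IS a
  Frobenioid) and at its re-basing `Toy.genuineTemperedFrobenioidConnectedPart Γ R S` over the GENUINE base `B^temp(Π)⁰` of ANY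
  topological group: `O^×(X) = 1` for EVERY object (`B₀^Λ → (Φ₀^ℝ)^gp` injective, `Toy.realifiedGenuine_divΛ_injective`, +
  abc-iut-w5-d250-lineage `unitsSubgroup_eq_bot_of_divΛ_injective`), so `μ_N(X) = 1`: (c1′) HOLDS for every `(G, ρ, N, M, m, χ')`
  but DEGENERATELY — a reading `m : μ_N(X) ≃ M` forces `M = 1`, and NO reading into the cyclotome `T'.mu` of ANY §2 datum
  `T' : ThetaEnvData N'` with `N' ≥ 2` exists (`|T'.mu| = N'`): F-1306 is not even INSTANTIABLE there.
VERDICT (R228): at both constructed tempered Frobenioids the clause is TRUE BUT ONLY VACUOUSLY INSTANTIABLE (the constants `𝔭^ℤ`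
carry no roots of unity); at every one-object-base model it reads «`χ'` trivial»; in general it reads «`χ'` = base-conjugation
character».  A positive instance of the sharp form needs a base object whose automorphisms MOVE torsion constants (Lemma 5.8
proof: "`Π^tp_Y` [i.e., `G_K` …] acts … via multiplication by an element of `μ_N(B_N)`") — cf. abc-iut-L2-t3's torsion data `ToyTorsion`
(`B₀ = ℤ × (ℤ/2)²` over `SingleObj ℤ`, swap action; its model Frobenioid is the subject of this seat's sequel).
HONEST FRAMING: kernel-checked truth values at constructed data; a FACT row is an assumption label, not an endorsement; no side
is taken on [IUTchIII] Cor. 3.12; typed ≠ proved.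
-/

noncomputable section

namespace Literature.AnabelianGeometry.EtaleTheta

open CategoryTheory Opposite Literature.AlgebraicGeometry.Frobenioids Literature.AnabelianGeometry.SemiGraphs

universe u₀ v₀ u v w u' uG uM

/-! ### §0 The clause evaluated below IS (c1′) of p438316 (bridge, by name) -/

namespace ThetaFrobenioid

section Bridge

variable {K : Type u₀} [Field K] {Xt : SemiGraphs.TemperedArithmeticGroup.{u₀} K} {D₀ : Type u₀} [Category.{v₀} D₀]
  {V : FrdIMonoidStub.{w}} {T₀ : RealifiedDivisorMonoids (D₀ := D₀) V} {D : Type u} [Category.{v} D]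
  {VD : FrdICatStub.{u, v, w} D} {S : BiKummerSetting Xt T₀ D VD}
  {pullFrac : ∀ {A A' : S.C} (_ : A' ⟶ A), S.biratUnits A → S.biratUnits A'}
  {lv N : ℕ+} {T : ThetaEnvData.{max v w} N} {θ : S.biratUnits S.Aodot} {Bl : S.C}
  {Pl : S.FractionPair θ Bl} {Rl : S.NthRoot θ Pl lv pullFrac}
  (h : ModelFrobenioid.Hypotheses S.tf.divisorMonoid S.tf.ratFnFunctor)
  (toB : ∀ A : S.C, S.biratUnits A →* S.tf.biratUnitsModel A) (Q : FrobenioidTheta.ThetaSubquotientStub.{w} D)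
  (odd_l : Odd (lv : ℕ)) (R : S.NthRoot Rl.root Rl.pair N pullFrac) (ιX : T.PiX ≃ₜ* Xt.Pi)
  (hopen : IsOpen ((S.galoisSurj R.AN.base R.αData.isGalois).ker : Set Xt.Pi)) (σ : Aut R.AN.base →* Aut R.AN)
  (K' : Type w) [Field K'] (constEmb : K'ˣ →* S.tf.biratUnitsModel R.BN)
  (constEmb_injective : Function.Injective constEmb)
  (hdivc : ∀ g : Aut R.BN.base,
    ModelFrobenioid.div ((σ ((BiKummerSetting.NthRoot.baseIso S R).conjAut.symm g)).hom ≫ R.pair.num) =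
      ModelFrobenioid.div R.pair.num)
  (hdivp : ∀ y : T.PiYdd,
    ModelFrobenioid.div ((σ (S.galoisSurj R.AN.base R.αData.isGalois (ιX y.1))).hom ≫ R.pair.den) =
      ModelFrobenioid.div R.pair.den)

/-- **Bridge (by name).**  For every §5 datum assembled over a tempered Frobenioid (`ofBiKummerData`, under `SgpCapSection`),
F-1306 `CyclotomicCharacterCompatX T' ι m` is LITERALLY the clause (c1′) studied in this file, at the model-Frobenioid object
`X := B_N = R.BN` of `S.tf`, the Galois action `ρ := rhoOfBiKummerData R ιX`, and the character `χ' := χ ∘ aug ∘ ι`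
(abc-iut-f-125 gen 2 `cyclotomicCharacterCompatX_ofBiKummerData_iff_ratFn`; `ThetaFrobenioid.ofBiKummerData_pre` is `rfl`).
[cite: MochizukiEtTh2009, Lem 5.8 proof p.331 (PDF p.105)] [cite: MochizukiFrdI2008, Thm. 5.2 (i) p.100] -/
theorem cyclotomicCharacterCompatX_ofBiKummerData_iff_ratFnClause
    (hsec : (ofBiKummerData h toB Q odd_l R ιX hopen σ K' constEmb constEmb_injective hdivc hdivp).SgpCapSection)
    (T' : ThetaEnvData.{max v w} N) (ι : T.PiX ≃* T'.PiX)
    (m : (ofBiKummerData h toB Q odd_l R ιX hopen σ K' constEmb constEmb_injective hdivc hdivp).muTorsion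
        (ofBiKummerData h toB Q odd_l R ιX hopen σ K' constEmb constEmb_injective hdivc hdivp).BN
        (ofBiKummerData h toB Q odd_l R ιX hopen σ K' constEmb constEmb_injective hdivc hdivp).N ≃* T'.mu) :
    (ofBiKummerData h toB Q odd_l R ιX hopen σ K' constEmb constEmb_injective hdivc hdivp).CyclotomicCharacterCompatX T' ι m ↔
      ∀ (g : T.PiX)
        (u u' : nTorsionIn ((PreFrobenioidData.ofModel S.tf.divisorMonoid S.tf.ratFnFunctor S.tf.divBNatTrans).unitsSubgroup
            R.BN)
          (fun _ hx _ hy => setLike_mul_comm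
            (s := (ofBiKummerData h toB Q odd_l R ιX hopen σ K' constEmb constEmb_injective hdivc hdivp).units R.BN) hx hy)
          (N : ℕ)),
        ModelFrobenioid.unit u'.1.hom = pull S.tf.ratFnFunctor (rhoOfBiKummerData R ιX g).inv (ModelFrobenioid.unit u.1.hom) →
          m u' = (T'.chi.comp (T'.aug.comp ι.toMonoidHom)) g (m u) :=
  cyclotomicCharacterCompatX_ofBiKummerData_iff_ratFn h toB Q odd_l R ιX hopen σ K' constEmb constEmb_injective hdivc hdivp
    hsec T' ι m

end Bridge

end ThetaFrobenioid

/-! ### §1 (c1′) over a model Frobenioid at an object with trivial base automorphisms: «`χ'` acts trivially» -/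

section General

variable {D : Type u} [Category.{v} D] {Φ B : Dᵒᵖ ⥤ CommMonCat.{w}} {DivB : B ⟶ monoidGp Φ}
  (X : ModelFrobenioid Φ B DivB)
  (hcomm : ∀ x ∈ (PreFrobenioidData.ofModel Φ B DivB).unitsSubgroup X,
    ∀ y ∈ (PreFrobenioidData.ofModel Φ B DivB).unitsSubgroup X, x * y = y * x)
  {G : Type uG} [Group G] (ρ : G →* Aut X.base) (N : ℕ) {M : Type uM} [Group M]

/-- `O^×(X)` of the operations `PreFrobenioidData.ofModel` ([FrdI] Thm. 5.2 (i), last sentence) is abc-iut-L1's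
`ModelFrobenioid.units X` = `O^×(X)` of the structure functor `C → F_Φ` (same carrier: base-identity linear automorphisms).
[cite: MochizukiFrdI2008, Thm. 5.2 (i) p.100] -/
theorem ofModel_unitsSubgroup_eq_unitsSubgroup_toElem :
    (PreFrobenioidData.ofModel Φ B DivB).unitsSubgroup X =
      PreFrobenioid.unitsSubgroup (ModelFrobenioid.toElem Φ B DivB) X :=
  SetLike.ext fun _ => Iff.rfl

/-- **(c1′) at an object with trivial base automorphisms ⟺ `χ'` acts trivially on `M`** (for `Φ` divisorial, [FrdI]
Thm. 5.2 (i): a unit is determined by its rational function, abc-iut-L1's `aut_eq_of_baseMap_eq_of_unit_eq`).  If every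
`ρ g` is the identity of `X^bs` — e.g. `X^bs` an object of a ONE-OBJECT base `D₀ = *` — then the hypothesis
`u_{u'} = B((ρ g)⁻¹)(u_u) = u_u` of the clause forces `u' = u`, and (c1′) reads `m u = χ'(g)(m u)` for all `g`, `u`.
[cite: MochizukiEtTh2009, Lem 5.8 proof p.331 (PDF p.105)] [cite: MochizukiFrdI2008, Thm. 5.2 (i) p.100] -/
theorem ratFnClause_iff_forall_chi_apply_eq_of_rho_inv_eq_id
    (m : nTorsionIn ((PreFrobenioidData.ofModel Φ B DivB).unitsSubgroup X) hcomm N ≃* M) (χ' : G →* MulAut M)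
    (hΦ : Objectwise (fun M _ => IsDivisorial M) Φ) (hρ : ∀ g : G, (ρ g).inv = 𝟙 X.base) :
    (∀ (g : G) (u u' : nTorsionIn ((PreFrobenioidData.ofModel Φ B DivB).unitsSubgroup X) hcomm N),
        ModelFrobenioid.unit u'.1.hom = pull B (ρ g).inv (ModelFrobenioid.unit u.1.hom) → m u' = χ' g (m u)) ↔
      ∀ (g : G) (x : M), χ' g x = x := by
  constructor
  · intro h g x
    have key := h g (m.symm x) (m.symm x) (by rw [hρ g, pull_id])
    rw [MulEquiv.apply_symm_apply] at key
    exact key.symm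
  · intro h g u u' huu'
    rw [hρ g, pull_id] at huu'
    have hb : ModelFrobenioid.baseMap u'.1.hom = ModelFrobenioid.baseMap u.1.hom := u'.2.1.1.trans u.2.1.1.symm
    have he : u' = u := Subtype.ext (ModelFrobenioid.aut_eq_of_baseMap_eq_of_unit_eq hΦ hb huu')
    rw [he, h]

/-- In particular, over a base object WITHOUT non-trivial automorphisms (`Subsingleton (X^bs ⟶ X^bs)`: the one-object
bases `Discrete PUnit` of the tree's toys), (c1′) holds iff `χ'` acts trivially on `M` — for EVERY Galois datum `ρ`.
[cite: MochizukiEtTh2009, Lem 5.8 proof p.331 (PDF p.105)] [cite: MochizukiFrdI2008, Thm. 5.2 (i) p.100] -/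
theorem ratFnClause_iff_forall_chi_apply_eq_of_subsingleton [Subsingleton (X.base ⟶ X.base)]
    (m : nTorsionIn ((PreFrobenioidData.ofModel Φ B DivB).unitsSubgroup X) hcomm N ≃* M) (χ' : G →* MulAut M)
    (hΦ : Objectwise (fun M _ => IsDivisorial M) Φ) :
    (∀ (g : G) (u u' : nTorsionIn ((PreFrobenioidData.ofModel Φ B DivB).unitsSubgroup X) hcomm N),
        ModelFrobenioid.unit u'.1.hom = pull B (ρ g).inv (ModelFrobenioid.unit u.1.hom) → m u' = χ' g (m u)) ↔
      ∀ (g : G) (x : M), χ' g x = x :=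
  ratFnClause_iff_forall_chi_apply_eq_of_rho_inv_eq_id X hcomm ρ N m χ' hΦ fun _ => Subsingleton.elim _ _

/-- Hence over such a base object (c1′) FAILS for every `χ'` that moves some element of `M` (the sharp form of F-1306 —
a non-trivial cyclotomic character — has NO instance there), whatever the Frobenioid.
[cite: MochizukiEtTh2009, Lem 5.8 proof p.331 (PDF p.105)] -/
theorem not_ratFnClause_of_subsingleton_of_chi_apply_ne [Subsingleton (X.base ⟶ X.base)]
    (m : nTorsionIn ((PreFrobenioidData.ofModel Φ B DivB).unitsSubgroup X) hcomm N ≃* M) (χ' : G →* MulAut M)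
    (hΦ : Objectwise (fun M _ => IsDivisorial M) Φ) {g : G} {x : M} (hx : χ' g x ≠ x) :
    ¬ ∀ (g : G) (u u' : nTorsionIn ((PreFrobenioidData.ofModel Φ B DivB).unitsSubgroup X) hcomm N),
        ModelFrobenioid.unit u'.1.hom = pull B (ρ g).inv (ModelFrobenioid.unit u.1.hom) → m u' = χ' g (m u) :=
  fun h => hx ((ratFnClause_iff_forall_chi_apply_eq_of_subsingleton X hcomm ρ N m χ' hΦ).mp h g x)

/-! ### §1a (c1′) ⟺ «`χ'` IS the base-conjugation character» whenever `ρ` admits a section `e : G → Aut_C(X)` -/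

/-- Conjugation by ANY automorphism `e ∈ Aut_C(X)` preserves `μ_N(X)` (`O^×(X)` is normal: `Base`, `deg_Fr` are
multiplicative; `(e u e⁻¹)^N = e u^N e⁻¹`).  [cite: MochizukiFrdI2008, Thm. 5.2 (i) p.100] -/
theorem conj_mem_nTorsionIn (e : Aut X) (u : nTorsionIn ((PreFrobenioidData.ofModel Φ B DivB).unitsSubgroup X) hcomm N) :
    e * u.1 * e⁻¹ ∈ nTorsionIn ((PreFrobenioidData.ofModel Φ B DivB).unitsSubgroup X) hcomm N := by
  refine ⟨⟨?_, ?_⟩, ?_⟩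
  · change ModelFrobenioid.baseMap (e.inv ≫ u.1.hom ≫ e.hom) = 𝟙 X.base
    exact ModelFrobenioid.baseMap_conj' e u.2.1.1
  · change ModelFrobenioid.degFr (e.inv ≫ u.1.hom ≫ e.hom) = 1
    exact ModelFrobenioid.degFr_conj' e u.2.1.2
  · rw [conj_pow, u.2.2, mul_one, mul_inv_cancel]

/-- Conjugating a torsion unit by `e` pulls its rational function back along `Base(e⁻¹)` ([FrdI] Thm. 5.2 (i); abc-iut-L2-t4's
`unit_conj_of_mem_units`); if `Base(e) = ρ g` this is `B((ρ g)⁻¹)`.  [cite: MochizukiFrdI2008, Thm. 5.2 (i) p.100] -/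
theorem unit_conj_eq_pull_rho_of_baseMap_eq (g : G) (e : Aut X) (he : ModelFrobenioid.baseMap e.hom = (ρ g).hom)
    (u : nTorsionIn ((PreFrobenioidData.ofModel Φ B DivB).unitsSubgroup X) hcomm N) :
    ModelFrobenioid.unit (e * u.1 * e⁻¹).hom = pull B (ρ g).inv (ModelFrobenioid.unit u.1.hom) := by
  have hinv : ModelFrobenioid.baseMap e.inv = (ρ g).inv := by
    rw [← Category.comp_id (ModelFrobenioid.baseMap e.inv), ← (ρ g).hom_inv_id, ← he, ← Category.assoc,
      ModelFrobenioid.baseMap_inv_comp_hom, Category.id_comp]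
  rw [← hinv]
  exact ThetaFrobenioid.unit_conj_of_mem_units e u.1 u.2.1

/-- **(c1′) ⟺ «`χ'` is the conjugation character of a section of `ρ`, read through `m`».**  If the Galois action
`ρ : G → Aut_D(X^bs)` lifts to a homomorphism `e : G → Aut_C(X)` (`Base ∘ e = ρ` — e.g. print's `s^trv_N` / `s^⊓-gp_N`, [FrdI]
Prop. 5.6, or any base-section), then (c1′) holds for `(m, χ')` IFF `χ'(g)(m u) = m(e(g) u e(g)⁻¹)` for all `g`, `u`: the
clause DETERMINES `χ'` as the base-conjugation character on `μ_N(X)`.  (F-1306 thus says: that character is the cyclotomic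
character of the §2 datum — "`Π^tp_Y` [i.e., `G_K` …] acts … via multiplication by an element of `μ_N(B_N)`".)
[cite: MochizukiEtTh2009, Lem 5.8 proof p.331 (PDF p.105)] [cite: MochizukiFrdI2008, Thm. 5.2 (i) p.100] -/
theorem ratFnClause_iff_forall_chi_apply_eq_conj_of_section
    (m : nTorsionIn ((PreFrobenioidData.ofModel Φ B DivB).unitsSubgroup X) hcomm N ≃* M) (χ' : G →* MulAut M)
    (hΦ : Objectwise (fun M _ => IsDivisorial M) Φ) (e : G →* Aut X)
    (he : ∀ g : G, ModelFrobenioid.baseMap (e g).hom = (ρ g).hom) :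
    (∀ (g : G) (u u' : nTorsionIn ((PreFrobenioidData.ofModel Φ B DivB).unitsSubgroup X) hcomm N),
        ModelFrobenioid.unit u'.1.hom = pull B (ρ g).inv (ModelFrobenioid.unit u.1.hom) → m u' = χ' g (m u)) ↔
      ∀ (g : G) (u : nTorsionIn ((PreFrobenioidData.ofModel Φ B DivB).unitsSubgroup X) hcomm N),
        χ' g (m u) = m ⟨e g * u.1 * (e g)⁻¹, conj_mem_nTorsionIn X hcomm N (e g) u⟩ := by
  constructor
  · intro h g u
    exact (h g u ⟨e g * u.1 * (e g)⁻¹, conj_mem_nTorsionIn X hcomm N (e g) u⟩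
      (unit_conj_eq_pull_rho_of_baseMap_eq X hcomm ρ N g (e g) (he g) u)).symm
  · intro h g u u' huu'
    have hb : ModelFrobenioid.baseMap u'.1.hom = ModelFrobenioid.baseMap (e g * u.1 * (e g)⁻¹).hom :=
      u'.2.1.1.trans (conj_mem_nTorsionIn X hcomm N (e g) u).1.1.symm
    have heq : u' = ⟨e g * u.1 * (e g)⁻¹, conj_mem_nTorsionIn X hcomm N (e g) u⟩ :=
      Subtype.ext (ModelFrobenioid.aut_eq_of_baseMap_eq_of_unit_eq hΦ hb
        (huu'.trans (unit_conj_eq_pull_rho_of_baseMap_eq X hcomm ρ N g (e g) (he g) u).symm))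
    rw [heq, h]

/-- Hence, given a section `e` of `ρ`, (c1′) HOLDS for the conjugation character itself (`M := μ_N(X)`, `m := id`,
`χ'(g) := e(g) (−) e(g)⁻¹`): the clause is ALWAYS satisfiable by the character the Frobenioid carries — F-1306's content is the
IDENTIFICATION of that character with `χ_cyc ∘ aug`.  [cite: MochizukiEtTh2009, Lem 5.8 proof p.331 (PDF p.105)] -/
theorem ratFnClause_of_section_of_forall_eq_conj
    (m : nTorsionIn ((PreFrobenioidData.ofModel Φ B DivB).unitsSubgroup X) hcomm N ≃* M) (χ' : G →* MulAut M)
    (hΦ : Objectwise (fun M _ => IsDivisorial M) Φ) (e : G →* Aut X)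
    (he : ∀ g : G, ModelFrobenioid.baseMap (e g).hom = (ρ g).hom)
    (hχ : ∀ (g : G) (u : nTorsionIn ((PreFrobenioidData.ofModel Φ B DivB).unitsSubgroup X) hcomm N),
      χ' g (m u) = m ⟨e g * u.1 * (e g)⁻¹, conj_mem_nTorsionIn X hcomm N (e g) u⟩) :
    ∀ (g : G) (u u' : nTorsionIn ((PreFrobenioidData.ofModel Φ B DivB).unitsSubgroup X) hcomm N),
        ModelFrobenioid.unit u'.1.hom = pull B (ρ g).inv (ModelFrobenioid.unit u.1.hom) → m u' = χ' g (m u) :=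
  (ratFnClause_iff_forall_chi_apply_eq_conj_of_section X hcomm ρ N m χ' hΦ e he).mpr hχ

/-! ### §1b (c1′) when `μ_N(X) = 1`: true for every datum, but only the trivial cyclotome can be read -/

/-- If `O^×(X) = 1` then `μ_N(X) = 1`. [cite: MochizukiEtTh2009, Def 5.4 p.327 (PDF p.101)] -/
theorem nTorsionIn_eq_bot_of_eq_bot (hX : (PreFrobenioidData.ofModel Φ B DivB).unitsSubgroup X = ⊥) :
    nTorsionIn ((PreFrobenioidData.ofModel Φ B DivB).unitsSubgroup X) hcomm N = ⊥ :=
  le_bot_iff.mp ((nTorsionIn_le _ hcomm N).trans hX.le)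

/-- If `μ_N(X) = 1`, every cyclotome reading `m : μ_N(X) ≃ M` has `M = 1`: every element of `M` is `1`.
[cite: MochizukiEtTh2009, Lem 5.8 proof p.331 (PDF p.105)] -/
theorem eq_one_of_nTorsionIn_eq_bot (m : nTorsionIn ((PreFrobenioidData.ofModel Φ B DivB).unitsSubgroup X) hcomm N ≃* M)
    (hT : nTorsionIn ((PreFrobenioidData.ofModel Φ B DivB).unitsSubgroup X) hcomm N = ⊥) (x : M) : x = 1 := by
  have hu : m.symm x = 1 := Subtype.ext (Subgroup.mem_bot.mp (hT.le (m.symm x).2))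
  rw [← m.apply_symm_apply x, hu, map_one]

/-- **If `μ_N(X) = 1`, (c1′) HOLDS for every `(G, ρ, N, M, m, χ')`** — degenerately: both sides are `1 ∈ M = 1`.
[cite: MochizukiEtTh2009, Lem 5.8 proof p.331 (PDF p.105)] -/
theorem ratFnClause_of_nTorsionIn_eq_bot
    (m : nTorsionIn ((PreFrobenioidData.ofModel Φ B DivB).unitsSubgroup X) hcomm N ≃* M) (χ' : G →* MulAut M)
    (hT : nTorsionIn ((PreFrobenioidData.ofModel Φ B DivB).unitsSubgroup X) hcomm N = ⊥) :
    ∀ (g : G) (u u' : nTorsionIn ((PreFrobenioidData.ofModel Φ B DivB).unitsSubgroup X) hcomm N),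
        ModelFrobenioid.unit u'.1.hom = pull B (ρ g).inv (ModelFrobenioid.unit u.1.hom) → m u' = χ' g (m u) :=
  fun g u u' _ => by
    rw [eq_one_of_nTorsionIn_eq_bot X hcomm N m hT (m u'), eq_one_of_nTorsionIn_eq_bot X hcomm N m hT (m u), map_one]

/-- **If `μ_N(X) = 1`, NO cyclotome reading into a non-trivial `M` exists** (`μ_N(X) ≃ M` forces `M = 1`).
[cite: MochizukiEtTh2009, Lem 5.8 proof p.331 (PDF p.105)] -/
theorem isEmpty_mulEquiv_of_nTorsionIn_eq_bot [Nontrivial M]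
    (hT : nTorsionIn ((PreFrobenioidData.ofModel Φ B DivB).unitsSubgroup X) hcomm N = ⊥) :
    IsEmpty (nTorsionIn ((PreFrobenioidData.ofModel Φ B DivB).unitsSubgroup X) hcomm N ≃* M) :=
  ⟨fun m' => by
    obtain ⟨x, y, hxy⟩ := exists_pair_ne M
    exact hxy ((eq_one_of_nTorsionIn_eq_bot X hcomm N m' hT x).trans
      (eq_one_of_nTorsionIn_eq_bot X hcomm N m' hT y).symm)⟩

/-- In particular NO reading `m : μ_N(X) ≃ μ_{N'}` into the cyclotome `T'.mu` of a §2 datum `T' : ThetaEnvData N'` of level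
`N' ≥ 2` exists (`|T'.mu| = N'`), so F-1306 `CyclotomicCharacterCompatX T' ι m` cannot even be INSTANTIATED at such `X`.
[cite: MochizukiEtTh2009, Lem 5.8 proof p.331 (PDF p.105); Prop 2.11 p.270 (PDF p.44)] -/
theorem isEmpty_mulEquiv_thetaEnvData_mu_of_nTorsionIn_eq_bot {N' : ℕ+} (T' : ThetaEnvData.{u'} N') (hN' : 1 < (N' : ℕ))
    (hT : nTorsionIn ((PreFrobenioidData.ofModel Φ B DivB).unitsSubgroup X) hcomm N = ⊥) :
    IsEmpty (nTorsionIn ((PreFrobenioidData.ofModel Φ B DivB).unitsSubgroup X) hcomm N ≃* T'.mu) := by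
  haveI : Nontrivial T'.mu := Fintype.one_lt_card_iff_nontrivial.mp (T'.card_mu ▸ hN')
  exact isEmpty_mulEquiv_of_nTorsionIn_eq_bot X hcomm N hT

end General

/-! ### §2 At abc-iut-w5-d164's `Toy.genuineTemperedFrobenioid` (one-object base, `B₀ = 𝔭^ℤ`): `μ_N = 1` -/

namespace Toy

section OneObject

variable (R S : ((Discrete PUnit.{1})ᵒᵖ ⥤ CommMonCat.{0}) → Prop) (X : (genuineTemperedFrobenioid R S).category)
  (hcomm : ∀ x ∈ (PreFrobenioidData.ofModel (genuineTemperedFrobenioid R S).divisorMonoid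
      (genuineTemperedFrobenioid R S).ratFnFunctor (genuineTemperedFrobenioid R S).divBNatTrans).unitsSubgroup X,
    ∀ y ∈ (PreFrobenioidData.ofModel (genuineTemperedFrobenioid R S).divisorMonoid
      (genuineTemperedFrobenioid R S).ratFnFunctor (genuineTemperedFrobenioid R S).divBNatTrans).unitsSubgroup X,
      x * y = y * x)
  {G : Type uG} [Group G] (ρ : G →* Aut X.base) (N : ℕ) {M : Type uM} [Group M]

/-- **`O^×(X) = 1` for EVERY object of the genuine toy tempered Frobenioid** ([EtTh] Thm. 3.7 (i)-style unit
triviality: `B₀^Λ(Y) → (Φ₀^ℝ)^gp(Y)`, `𝔭^k ↦ ι(𝔭)^k`, is injective — abc-iut-w5-d164's `realifiedGenuine_divΛ_injective` —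
and the toy IS a Frobenioid; abc-iut-w5-d250-lineage `unitsSubgroup_eq_bot_of_divΛ_injective`).
[cite: MochizukiEtTh2009, Thm 3.7 (i) p.305 (PDF p.79)] -/
theorem ofModel_unitsSubgroup_eq_bot_genuineTemperedFrobenioid :
    (PreFrobenioidData.ofModel (genuineTemperedFrobenioid R S).divisorMonoid (genuineTemperedFrobenioid R S).ratFnFunctor
        (genuineTemperedFrobenioid R S).divBNatTrans).unitsSubgroup X = ⊥ := by
  rw [ofModel_unitsSubgroup_eq_unitsSubgroup_toElem]
  exact (genuineTemperedFrobenioid R S).unitsSubgroup_eq_bot_of_divΛ_injective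
    (isFrobenioid_genuineTemperedFrobenioid R S) (fun A => realifiedGenuine_divΛ_injective _) X

/-- Hence `μ_N(X) = 1` for every object and every `N`. [cite: MochizukiEtTh2009, Def 5.4 p.327 (PDF p.101)] -/
theorem nTorsionIn_eq_bot_genuineTemperedFrobenioid :
    nTorsionIn ((PreFrobenioidData.ofModel (genuineTemperedFrobenioid R S).divisorMonoid
      (genuineTemperedFrobenioid R S).ratFnFunctor (genuineTemperedFrobenioid R S).divBNatTrans).unitsSubgroup X)
        hcomm N = ⊥ :=
  nTorsionIn_eq_bot_of_eq_bot X hcomm N (ofModel_unitsSubgroup_eq_bot_genuineTemperedFrobenioid R S X)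

/-- **(c1′) HOLDS at the genuine toy for EVERY datum `(G, ρ, N, M, m, χ')`** — degenerately (`μ_N(X) = 1`, `M = 1`).
[cite: MochizukiEtTh2009, Lem 5.8 proof p.331 (PDF p.105)] -/
theorem ratFnClause_genuineTemperedFrobenioid
    (m : nTorsionIn ((PreFrobenioidData.ofModel (genuineTemperedFrobenioid R S).divisorMonoid
      (genuineTemperedFrobenioid R S).ratFnFunctor (genuineTemperedFrobenioid R S).divBNatTrans).unitsSubgroup X)
        hcomm N ≃* M) (χ' : G →* MulAut M) :
    ∀ (g : G) (u u' : nTorsionIn ((PreFrobenioidData.ofModel (genuineTemperedFrobenioid R S).divisorMonoid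
        (genuineTemperedFrobenioid R S).ratFnFunctor (genuineTemperedFrobenioid R S).divBNatTrans).unitsSubgroup X)
          hcomm N),
      ModelFrobenioid.unit u'.1.hom =
          pull (genuineTemperedFrobenioid R S).ratFnFunctor (ρ g).inv (ModelFrobenioid.unit u.1.hom) →
        m u' = χ' g (m u) :=
  ratFnClause_of_nTorsionIn_eq_bot X hcomm ρ N m χ' (nTorsionIn_eq_bot_genuineTemperedFrobenioid R S X hcomm N)

/-- **… but NO cyclotome reading `m : μ_N(X) ≃ T'.mu` into a §2 datum of level `N' ≥ 2` exists at the genuine toy**: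
F-1306's sharp form is NOT INSTANTIABLE there (the constants `𝔭^ℤ` carry no roots of unity).
[cite: MochizukiEtTh2009, Lem 5.8 proof p.331 (PDF p.105)] -/
theorem isEmpty_mulEquiv_thetaEnvData_mu_genuineTemperedFrobenioid {N' : ℕ+} (T' : ThetaEnvData.{u'} N')
    (hN' : 1 < (N' : ℕ)) :
    IsEmpty (nTorsionIn ((PreFrobenioidData.ofModel (genuineTemperedFrobenioid R S).divisorMonoid
      (genuineTemperedFrobenioid R S).ratFnFunctor (genuineTemperedFrobenioid R S).divBNatTrans).unitsSubgroup X)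
        hcomm N ≃* T'.mu) :=
  isEmpty_mulEquiv_thetaEnvData_mu_of_nTorsionIn_eq_bot X hcomm N T' hN'
    (nTorsionIn_eq_bot_genuineTemperedFrobenioid R S X hcomm N)

end OneObject

/-! ### §3 At the re-based toy over the GENUINE base `B^temp(Π)⁰` of any topological group `Π`: `μ_N = 1` -/

section ConnectedPartBase

variable (Γ : Type u') [Group Γ] [TopologicalSpace Γ] (R S : ((ConnectedPart (BTemp Γ))ᵒᵖ ⥤ CommMonCat.{0}) → Prop)
  (X : (genuineTemperedFrobenioidConnectedPart Γ R S).category)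
  (hcomm : ∀ x ∈ (PreFrobenioidData.ofModel (genuineTemperedFrobenioidConnectedPart Γ R S).divisorMonoid
      (genuineTemperedFrobenioidConnectedPart Γ R S).ratFnFunctor
      (genuineTemperedFrobenioidConnectedPart Γ R S).divBNatTrans).unitsSubgroup X,
    ∀ y ∈ (PreFrobenioidData.ofModel (genuineTemperedFrobenioidConnectedPart Γ R S).divisorMonoid
      (genuineTemperedFrobenioidConnectedPart Γ R S).ratFnFunctor
      (genuineTemperedFrobenioidConnectedPart Γ R S).divBNatTrans).unitsSubgroup X,
      x * y = y * x)
  {G : Type uG} [Group G] (ρ : G →* Aut X.base) (N : ℕ) {M : Type uM} [Group M]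

/-- **`O^×(X) = 1` for EVERY object of the re-based toy over `B^temp(Π)⁰`** (base functor constant on the one-object `D₀`,
`B₀ = 𝔭^ℤ`; the re-based toy IS a Frobenioid, abc-iut-w5-d164's `isFrobenioid_genuineTemperedFrobenioidConnectedPart`).
[cite: MochizukiEtTh2009, Thm 3.7 (i) p.305 (PDF p.79)] -/
theorem ofModel_unitsSubgroup_eq_bot_genuineTemperedFrobenioidConnectedPart :
    (PreFrobenioidData.ofModel (genuineTemperedFrobenioidConnectedPart Γ R S).divisorMonoid
        (genuineTemperedFrobenioidConnectedPart Γ R S).ratFnFunctor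
        (genuineTemperedFrobenioidConnectedPart Γ R S).divBNatTrans).unitsSubgroup X = ⊥ := by
  rw [ofModel_unitsSubgroup_eq_unitsSubgroup_toElem]
  exact (genuineTemperedFrobenioidConnectedPart Γ R S).unitsSubgroup_eq_bot_of_divΛ_injective
    (isFrobenioid_genuineTemperedFrobenioidConnectedPart Γ R S) (fun A => realifiedGenuine_divΛ_injective _) X

/-- Hence `μ_N(X) = 1` over `B^temp(Π)⁰` too. [cite: MochizukiEtTh2009, Def 5.4 p.327 (PDF p.101)] -/
theorem nTorsionIn_eq_bot_genuineTemperedFrobenioidConnectedPart :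
    nTorsionIn ((PreFrobenioidData.ofModel (genuineTemperedFrobenioidConnectedPart Γ R S).divisorMonoid
      (genuineTemperedFrobenioidConnectedPart Γ R S).ratFnFunctor
      (genuineTemperedFrobenioidConnectedPart Γ R S).divBNatTrans).unitsSubgroup X) hcomm N = ⊥ :=
  nTorsionIn_eq_bot_of_eq_bot X hcomm N (ofModel_unitsSubgroup_eq_bot_genuineTemperedFrobenioidConnectedPart Γ R S X)

/-- **(c1′) HOLDS at the re-based toy over `B^temp(Π)⁰` for EVERY datum** — here the base object `X^bs` (a connected
`Π`-set) may well have non-trivial automorphisms and `ρ` may be the genuine Galois action, but `μ_N(X) = 1` makes the clause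
degenerate all the same.  [cite: MochizukiEtTh2009, Lem 5.8 proof p.331 (PDF p.105)] -/
theorem ratFnClause_genuineTemperedFrobenioidConnectedPart
    (m : nTorsionIn ((PreFrobenioidData.ofModel (genuineTemperedFrobenioidConnectedPart Γ R S).divisorMonoid
      (genuineTemperedFrobenioidConnectedPart Γ R S).ratFnFunctor
      (genuineTemperedFrobenioidConnectedPart Γ R S).divBNatTrans).unitsSubgroup X) hcomm N ≃* M) (χ' : G →* MulAut M) :
    ∀ (g : G) (u u' : nTorsionIn ((PreFrobenioidData.ofModel (genuineTemperedFrobenioidConnectedPart Γ R S).divisorMonoid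
        (genuineTemperedFrobenioidConnectedPart Γ R S).ratFnFunctor
        (genuineTemperedFrobenioidConnectedPart Γ R S).divBNatTrans).unitsSubgroup X) hcomm N),
      ModelFrobenioid.unit u'.1.hom =
          pull (genuineTemperedFrobenioidConnectedPart Γ R S).ratFnFunctor (ρ g).inv (ModelFrobenioid.unit u.1.hom) →
        m u' = χ' g (m u) :=
  ratFnClause_of_nTorsionIn_eq_bot X hcomm ρ N m χ'
    (nTorsionIn_eq_bot_genuineTemperedFrobenioidConnectedPart Γ R S X hcomm N)

/-- **… and NO cyclotome reading into a §2 datum of level `N' ≥ 2` exists over `B^temp(Π)⁰` either.**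
[cite: MochizukiEtTh2009, Lem 5.8 proof p.331 (PDF p.105)] -/
theorem isEmpty_mulEquiv_thetaEnvData_mu_genuineTemperedFrobenioidConnectedPart {N' : ℕ+}
    (T' : ThetaEnvData.{u₀} N') (hN' : 1 < (N' : ℕ)) :
    IsEmpty (nTorsionIn ((PreFrobenioidData.ofModel (genuineTemperedFrobenioidConnectedPart Γ R S).divisorMonoid
      (genuineTemperedFrobenioidConnectedPart Γ R S).ratFnFunctor
      (genuineTemperedFrobenioidConnectedPart Γ R S).divBNatTrans).unitsSubgroup X) hcomm N ≃* T'.mu) :=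
  isEmpty_mulEquiv_thetaEnvData_mu_of_nTorsionIn_eq_bot X hcomm N T' hN'
    (nTorsionIn_eq_bot_genuineTemperedFrobenioidConnectedPart Γ R S X hcomm N)

end ConnectedPartBase

end Toy

end Literature.AnabelianGeometry.EtaleTheta

end
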